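import Summits.BirchSwinnertonDyer.Rank1Residual.Additive.KobayashiLogFss
import Literature.NumberTheory.EllipticCurves.FormalGroupFrobeniusTypeProofs
import Literature.RingTheory.FormalGroups.HondaTypeFunctionalEquationII
import Literature.RingTheory.FormalGroups.DworkFrobeniusLift
import HarnessLib

/-!
# Honda's isomorphism `i = exp_E ∘ log_{F_ss} ∈ Xℤ_p⟦X⟧` between Kobayashi's formal group `F_ss`
# and the formal group of a good supersingular `a_p = 0` model `M/ℤ_p` (`p` odd), its inverse
# `j = exp_{F_ss} ∘ log_E ∈ Xℤ_p⟦X⟧`, and the identities `log_E ∘ i = log_{F_ss}`, `i ∘ j = j ∘ i = X`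
# (cell `b2b-bsdres`, CLASS-CLOSURE lane, class O10 — x1b GEN 33, class lead; file 29 of the local
# series: [K] Prop. 8.4 / Thm. 8.3 via the tree's Honda lemma `norm_coeff_le_one_of_subst_eq`)

HONEST FRAMING (cell `b2b-bsdres`, run/shared/lean/b2b/bsd-rank1-residual/, verbatim in every
file): the goal of the cell is to DELETE the COMBINATION-SHAPED residual classes of the
Birch–Swinnerton-Dyer formula for ALL analytic-rank `≤ 1` elliptic curves over `ℚ` — "full BSD
formula for every rank `≤ 1` curve in class `C`" assembled STRICTLY from published theorems — so
that the rank-`≤ 1` remainder becomes exactly the CONSTRUCTION-SHAPED classes, which are TYPED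
(missing-input `Prop`s), NOT attempted. This is not "finishing BSD". CLASS-CLOSURE lane: prove
what is provable now; shrink each hard class to its core with data; no claim beyond stated classes;
research routes on CONSTRUCTION-SHAPED X12 / O10; census / instrument output = EVIDENCE / conjecture
items, NEVER a Literature fact; `RESIDUAL-MAP.md` marks change only by signed lines. THIS FILE:
TOOL DEFINITIONS + THEOREMS (definitions with bodies: `hondaPsi`, `hondaPsiInv`, `hondaIso`,
`hondaIsoInv`; every statement proved) — no named Literature fact, no Summits-side fact
`def … : Prop`, no `sorry`, axioms standard; nothing is booked; no label / mark / count / sub-cell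
moves; O10 stays OPEN / CONSTRUCTION-SHAPED; nothing about `BSD(W, p)` of any pair is claimed.

## Content (`M/ℤ_p`, `W = M ⊗ ℚ_p`, `log_E = formalLog W`, `exp_E = formalExp W`)

* §1 `hondaPsi = exp_E ∘ log_{F_ss} ∈ ℚ_p⟦X⟧`, `log_E ∘ hondaPsi = log_{F_ss}`; `hondaPsiInv` (its
  compositional inverse), `log_{F_ss} ∘ hondaPsiInv = log_E`, `hondaPsi ∘ hondaPsiInv = X` and
  conversely.
* §2 Under `p ≠ 2`, elliptic generic AND special fibre, and `a_p(M) := HasseManin.tr (M ⊗ 𝔽_p) = 0`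
  (`log_E` of Honda type `T² + p`, the tree's `norm_coeff_hondaShift_formalLog_le_one`):
  **`norm_coeff_hondaPsi_le_one`, `norm_coeff_hondaPsiInv_le_one`** (Honda's theorem, the tree's
  `norm_coeff_le_one_of_subst_eq`, with `log_{F_ss}` of the same type, file 27); the integral
  series **`hondaIso`, `hondaIsoInv ∈ Xℤ_p⟦X⟧`** (`liftInt`) with `map_hondaIso`, and the
  identities `hondaIso ∘ hondaIsoInv = X = hondaIsoInv ∘ hondaIso` over `ℤ_p`.

References: [Kobayashi2003] §8.1–8.2 (Thm. 8.3, Prop. 8.4: "`exp_Ê ∘ log_{F_ss}(X) ∈ ℤ_p⟦X⟧`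
gives an isomorphism `F_ss → Ê`"); [Honda1970] Thm. 2, Thm. 9.
-/

noncomputable section

open scoped Classical
open PowerSeries

namespace Summit.BirchSwinnertonDyer.Rank1Residual.Additive

namespace HondaFss

open Literature.RingTheory.FormalGroups WeierstrassCurve

variable (p : ℕ) [hp : Fact p.Prime] (M : WeierstrassCurve ℤ_[p])

/-! ## §1 `ψ = exp_E ∘ log_{F_ss}` and its inverse -/

/-- **`ψ = exp_E ∘ log_{F_ss} ∈ ℚ_p⟦X⟧`** (`E = M ⊗ ℚ_p`). [cite: Kobayashi2003, Prop. 8.4] -/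
def hondaPsi : ℚ_[p]⟦X⟧ := (M.map (PadicInt.Coe.ringHom (p := p))).formalExp.subst (logFss p)

/-- `HasSubst log_{F_ss}`. [folklore] -/
theorem hasSubst_logFss : HasSubst (logFss p) := HasSubst.of_constantCoeff_zero' (constantCoeff_logFss p)

/-- `ψ(0) = 0`. [folklore] -/
theorem constantCoeff_hondaPsi : constantCoeff (hondaPsi p M) = 0 := by
  rw [hondaPsi, constantCoeff_subst_of_constantCoeff_eq_zero (constantCoeff_logFss p),
    (M.map PadicInt.Coe.ringHom).constantCoeff_formalExp]

/-- `HasSubst ψ`. [folklore] -/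
theorem hasSubst_hondaPsi : HasSubst (hondaPsi p M) := HasSubst.of_constantCoeff_zero' (constantCoeff_hondaPsi p M)

/-- `HasSubst exp_E`. [folklore] -/
theorem hasSubst_formalExp' : HasSubst (M.map (PadicInt.Coe.ringHom (p := p))).formalExp :=
  HasSubst.of_constantCoeff_zero' (M.map PadicInt.Coe.ringHom).constantCoeff_formalExp

/-- `HasSubst log_E`. [folklore] -/
theorem hasSubst_formalLog' : HasSubst (M.map (PadicInt.Coe.ringHom (p := p))).formalLog :=
  HasSubst.of_constantCoeff_zero' (M.map PadicInt.Coe.ringHom).constantCoeff_formalLog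

/-- **`log_E ∘ ψ = log_{F_ss}`** (`log_E ∘ exp_E = X`). [cite: Kobayashi2003, Prop. 8.4] -/
theorem formalLog_subst_hondaPsi :
    (M.map (PadicInt.Coe.ringHom (p := p))).formalLog.subst (hondaPsi p M) = logFss p := by
  rw [hondaPsi, ← PowerSeries.subst_comp_subst_apply (hasSubst_formalExp' p M) (hasSubst_logFss p),
    (M.map PadicInt.Coe.ringHom).formalLog_subst_formalExp, PowerSeries.subst_X (hasSubst_logFss p)]

/-- `[X¹]ψ = [X¹]log_{F_ss}` is a unit. [folklore] -/
theorem isUnit_coeff_one_hondaPsi : IsUnit (coeff 1 (hondaPsi p M)) := by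
  -- from `log_E ∘ ψ = log_{F_ss}`: `[X¹](log_E ∘ ψ) = log₀·[X¹]ψ⁰ + log₁ · [X¹]ψ = [X¹]ψ`
  have h := congrArg (coeff 1) (formalLog_subst_hondaPsi p M)
  rw [coeff_subst_eq_sum (constantCoeff_hondaPsi p M), Finset.sum_range_succ, Finset.sum_range_succ,
    Finset.sum_range_zero, zero_add, PowerSeries.coeff_zero_eq_constantCoeff,
    (M.map PadicInt.Coe.ringHom).constantCoeff_formalLog, zero_mul, zero_add,
    (M.map PadicInt.Coe.ringHom).coeff_one_formalLog, one_mul, pow_one] at h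
  rw [h, isUnit_iff_ne_zero, ← norm_pos_iff, norm_coeff_one_logFss]
  exact one_pos

/-- **`ψ⁻¹`**, the compositional inverse of `ψ` (`= exp_{F_ss} ∘ log_E`). [cite: Kobayashi2003, Prop. 8.4] -/
def hondaPsiInv : ℚ_[p]⟦X⟧ := PowerSeries.substInvOfIsUnit (hondaPsi p M) (isUnit_coeff_one_hondaPsi p M)

/-- `ψ⁻¹(0) = 0`. [folklore] -/
theorem constantCoeff_hondaPsiInv : constantCoeff (hondaPsiInv p M) = 0 :=
  PowerSeries.constantCoeff_substInvOfIsUnit _ _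

/-- `HasSubst ψ⁻¹`. [folklore] -/
theorem hasSubst_hondaPsiInv : HasSubst (hondaPsiInv p M) := PowerSeries.HasSubst.substInvOfIsUnit _ _

/-- `ψ ∘ ψ⁻¹ = X`. [folklore] -/
theorem hondaPsi_subst_hondaPsiInv : (hondaPsi p M).subst (hondaPsiInv p M) = X :=
  PowerSeries.subst_substInvOfIsUnit_right _ (constantCoeff_hondaPsi p M) _

/-- `ψ⁻¹ ∘ ψ = X`. [folklore] -/
theorem hondaPsiInv_subst_hondaPsi : (hondaPsiInv p M).subst (hondaPsi p M) = X :=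
  PowerSeries.subst_substInvOfIsUnit_left _ (constantCoeff_hondaPsi p M) _

/-- **`log_{F_ss} ∘ ψ⁻¹ = log_E`.** [cite: Kobayashi2003, Prop. 8.4] -/
theorem logFss_subst_hondaPsiInv :
    (logFss p).subst (hondaPsiInv p M) = (M.map (PadicInt.Coe.ringHom (p := p))).formalLog := by
  rw [← formalLog_subst_hondaPsi p M, PowerSeries.subst_comp_subst_apply (hasSubst_hondaPsi p M)
    (hasSubst_hondaPsiInv p M), hondaPsi_subst_hondaPsiInv, PowerSeries.X_subst]

/-! ## §2 Integrality (Honda) for a good supersingular `a_p = 0` model, `p` odd -/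

variable [hE : (M.map PadicInt.Coe.ringHom).IsElliptic] [hEt : (M.map PadicInt.toZMod).IsElliptic]

/-- `log_E` is of Honda type `T² + p` when `a_p(M) = 0` (the tree's Honda congruences, `p` odd).
[cite: Kobayashi2003, Prop. 8.4] -/
theorem norm_coeff_hondaShift_formalLog_le_one_of_tr_eq_zero (hp2 : p ≠ 2)
    (htr : Literature.NumberTheory.EllipticCurves.HasseManin.tr (M.map PadicInt.toZMod) = 0) (n : ℕ) :
    ‖coeff n (hondaShift p 0 (M.map (PadicInt.Coe.ringHom (p := p))).formalLog)‖ ≤ 1 := by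
  have h := M.norm_coeff_hondaShift_formalLog_le_one hp2 n
  rwa [htr, Int.cast_zero] at h

/-- **`ψ = exp_E ∘ log_{F_ss} ∈ ℤ_p⟦X⟧`** (Honda: two logarithms of the same type `T² + p`).
[cite: Kobayashi2003, Prop. 8.4] -/
theorem norm_coeff_hondaPsi_le_one (hp2 : p ≠ 2)
    (htr : Literature.NumberTheory.EllipticCurves.HasseManin.tr (M.map PadicInt.toZMod) = 0) (n : ℕ) :
    ‖coeff n (hondaPsi p M)‖ ≤ 1 := by
  refine norm_coeff_le_one_of_subst_eq (p := p) (a := 0) (by simp)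
    (norm_coeff_hondaShift_formalLog_le_one_of_tr_eq_zero p M hp2 htr) (norm_coeff_hondaShift_logFss_le_one p)
    ?_ (constantCoeff_hondaPsi p M) (formalLog_subst_hondaPsi p M) n
  rw [(M.map PadicInt.Coe.ringHom).coeff_one_formalLog, norm_one]

/-- **`ψ⁻¹ = exp_{F_ss} ∘ log_E ∈ ℤ_p⟦X⟧`** (Honda, roles exchanged). [cite: Kobayashi2003, Prop. 8.4] -/
theorem norm_coeff_hondaPsiInv_le_one (hp2 : p ≠ 2)
    (htr : Literature.NumberTheory.EllipticCurves.HasseManin.tr (M.map PadicInt.toZMod) = 0) (n : ℕ) :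
    ‖coeff n (hondaPsiInv p M)‖ ≤ 1 :=
  norm_coeff_le_one_of_subst_eq (p := p) (a := 0) (by simp) (norm_coeff_hondaShift_logFss_le_one p)
    (norm_coeff_hondaShift_formalLog_le_one_of_tr_eq_zero p M hp2 htr) (norm_coeff_one_logFss p)
    (constantCoeff_hondaPsiInv p M) (logFss_subst_hondaPsiInv p M) n

/-- **Honda's isomorphism `i : F_ss → Ê` as an integral series** (`ψ` lifted to `ℤ_p⟦X⟧`).
[cite: Kobayashi2003, Prop. 8.4] -/
def hondaIso (hp2 : p ≠ 2)
    (htr : Literature.NumberTheory.EllipticCurves.HasseManin.tr (M.map PadicInt.toZMod) = 0) : ℤ_[p]⟦X⟧ :=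
  liftInt (hondaPsi p M) (norm_coeff_hondaPsi_le_one p M hp2 htr)

/-- **The inverse isomorphism `j : Ê → F_ss`** as an integral series. [cite: Kobayashi2003, Prop. 8.4] -/
def hondaIsoInv (hp2 : p ≠ 2)
    (htr : Literature.NumberTheory.EllipticCurves.HasseManin.tr (M.map PadicInt.toZMod) = 0) : ℤ_[p]⟦X⟧ :=
  liftInt (hondaPsiInv p M) (norm_coeff_hondaPsiInv_le_one p M hp2 htr)

variable {p M}
variable (hp2 : p ≠ 2) (htr : Literature.NumberTheory.EllipticCurves.HasseManin.tr (M.map PadicInt.toZMod) = 0)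

/-- `hondaIso ⊗ ℚ_p = ψ`. [folklore] -/
theorem map_hondaIso : (hondaIso p M hp2 htr).map PadicInt.Coe.ringHom = hondaPsi p M := map_liftInt _ _

/-- `hondaIsoInv ⊗ ℚ_p = ψ⁻¹`. [folklore] -/
theorem map_hondaIsoInv : (hondaIsoInv p M hp2 htr).map PadicInt.Coe.ringHom = hondaPsiInv p M := map_liftInt _ _

/-- `PowerSeries.map` along `ℤ_p → ℚ_p` is injective. [folklore] -/
theorem map_injective : Function.Injective (PowerSeries.map (PadicInt.Coe.ringHom (p := p))) := by
  intro f g h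
  ext n
  have := congrArg (coeff n) h
  rw [coeff_map, coeff_map] at this
  exact Subtype.ext this

/-- `i(0) = 0`. [folklore] -/
theorem constantCoeff_hondaIso : constantCoeff (hondaIso p M hp2 htr) = 0 := by
  have h := congrArg (coeff 0) (map_hondaIso hp2 htr)
  rw [coeff_map, PowerSeries.coeff_zero_eq_constantCoeff, PowerSeries.coeff_zero_eq_constantCoeff,
    constantCoeff_hondaPsi] at h
  exact Subtype.ext h

/-- `j(0) = 0`. [folklore] -/
theorem constantCoeff_hondaIsoInv : constantCoeff (hondaIsoInv p M hp2 htr) = 0 := by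
  have h := congrArg (coeff 0) (map_hondaIsoInv hp2 htr)
  rw [coeff_map, PowerSeries.coeff_zero_eq_constantCoeff, PowerSeries.coeff_zero_eq_constantCoeff,
    constantCoeff_hondaPsiInv] at h
  exact Subtype.ext h

/-- **`i ∘ j = X`** over `ℤ_p`. [cite: Kobayashi2003, Prop. 8.4] -/
theorem hondaIso_subst_hondaIsoInv : (hondaIso p M hp2 htr).subst (hondaIsoInv p M hp2 htr) = X := by
  apply map_injective
  rw [map_subst_apply (HasSubst.of_constantCoeff_zero' (constantCoeff_hondaIsoInv hp2 htr)),
    map_hondaIso, map_hondaIsoInv, PowerSeries.map_X]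
  exact hondaPsi_subst_hondaPsiInv p M

/-- **`j ∘ i = X`** over `ℤ_p`. [cite: Kobayashi2003, Prop. 8.4] -/
theorem hondaIsoInv_subst_hondaIso : (hondaIsoInv p M hp2 htr).subst (hondaIso p M hp2 htr) = X := by
  apply map_injective
  rw [map_subst_apply (HasSubst.of_constantCoeff_zero' (constantCoeff_hondaIso hp2 htr)),
    map_hondaIso, map_hondaIsoInv, PowerSeries.map_X]
  exact hondaPsiInv_subst_hondaPsi p M

/-- **`log_E ∘ (i ⊗ ℚ_p) = log_{F_ss}`** (restated with `hondaIso`). [cite: Kobayashi2003, Prop. 8.4] -/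
theorem formalLog_subst_map_hondaIso :
    (M.map (PadicInt.Coe.ringHom (p := p))).formalLog.subst ((hondaIso p M hp2 htr).map PadicInt.Coe.ringHom) =
      logFss p := by
  rw [map_hondaIso]; exact formalLog_subst_hondaPsi p M

end HondaFss

end Summit.BirchSwinnertonDyer.Rank1Residual.Additive

end
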